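import Mathlib
import Literature.MathematicalPhysics.MHD.FluxSurfaceGeometry
import HarnessLib

/-!
# The flux-surface average `⟨a⟩` (Jardin 2010, (5.30)) and Jardin's surface functions `V′` (5.29),
# `Φ′` (5.31), `I` (5.34), `q` (5.35) in the tree's Grad–Shafranov vocabulary; consistency with
# Freidberg's `dV/dψ` (6.22), `∮B_p dl` (6.27), `q` (6.35) (proved)

Source read on the page: S. Jardin, *Computational Methods in Plasma Physics* (CRC 2010) §5.2–§5.3
[galaxy:panama:478966162915417 chars 316000–336000; bib `Jardin2010`]: with flux coordinates `(ψ, θ, φ)`,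
Jacobian `J`, `B = ∇φ × ∇Ψ + g(Ψ)∇φ` (5.24) (so `|B_p| = |∇Ψ|/R`, the same per-radian flux function as
Freidberg's `ψ`),
* (5.23) `dℓ = (|∇ψ| J/R) dθ` — arc length along a constant-`ψ` contour;
* (5.29) `V′(ψ) ≡ dV/dψ = 2π ∫₀^{2π} J dθ = 2π ∮ R dℓ/|∇ψ|`;
* (5.30) `⟨a⟩ = (2π/V′) ∫₀^{2π} J a dθ` — the SURFACE AVERAGE of a scalar `a(ψ, θ)`;
* (5.31) `Φ(ψ) = (1/2π)∫_{ψ₀}^{ψ} dψ g V′⟨R⁻²⟩` (toroidal flux), (5.32) `Ψ_p = 2π(Ψ − Ψ₀)`,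
  (5.34) `I(ψ) = (Ψ′/2πμ₀) V′⟨|∇ψ|²/R²⟩` (toroidal current), (5.35) `q = Φ′/Ψ_p′ = gV′⟨R⁻²⟩/((2π)²Ψ′)`.

THIS FILE types these with the LABEL `ψ := Ψ` (the flux function itself, so `Ψ′ = 1`, `R/|∇Ψ| = 1/B_p`)
over a poloidal loop `γ : [0, T] → (R, Z)` tracing the surface once, with EUCLIDEAN arc length
(`GradShafranov.loopIntegralE`, LADDER-GRIDFUSION RULING 15), i.e. in the vocabulary already used for Freidberg's
functionals in `GradShafranov.lean`:

* `surfaceAverageE ψ γ T a := 2π·∮ a dℓ/B_p / volumeDerivE ψ γ T` — (5.30) rewritten with (5.23):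
  `J a dθ = a R dℓ/|∇Ψ| = a dℓ/B_p`; `volumeDerivE` is Freidberg's (6.22) `2π∮dℓ/B_p`, which IS (5.29)
  (`volumeDerivE_eq_jardin`, for loops in the right half plane);
* algebra of `⟨·⟩` (proved): `⟨1⟩ = 1`, `⟨c·a⟩ = c⟨a⟩`, `⟨a + b⟩ = ⟨a⟩ + ⟨b⟩`, `⟨a⟩ = ⟨b⟩` when `a = b`
  along the loop, `⟨a⟩ = k` when `a ≡ k` on the surface;
* `toroidalFluxDerivJ g ψ γ T` = the `ψ`-derivative of (5.31), `(1/2π) g V′⟨R⁻²⟩`; `safetyFactorJ` = (5.35)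
  with `Ψ′ = 1`; `toroidalCurrentJ` = (5.34) with `Ψ′ = 1`; and the CONSISTENCY THEOREMS (two printed sources
  agree): `safetyFactorJ = safetyFactorE` (Jardin (5.35) = Freidberg (6.35)), `toroidalFluxDerivJ = 2π·safetyFactorE`
  (so `Φ′ = 2πq`, `Φ″ = 2π dq/dΨ` in the label `Ψ`), `toroidalCurrentJ = toroidalCurrentE` (Jardin (5.34) =
  Freidberg (6.27)) — each under the single hypothesis `V′ ≠ 0` (a regular surface).

Purpose (LADDER-GRIDFUSION F1.MERCIER-profile): these are the functionals producing the real inputs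
`V′, Φ′, I′` and the averages `⟨B²/|∇ψ|²⟩, ⟨σB²/|∇ψ|²⟩, ⟨σ²B²/|∇ψ|²⟩, ⟨1/B²⟩` of the
Glasser–Greene–Johnson form of Mercier's criterion as printed by Jardin (8.134) (typed separately by
gridfusion-lit-3 with real inputs). NOT here: (8.134) itself, `σ = J·B/B²` (8.50), the `ψ`-derivatives
`V″, Φ″` (per-family theorems, e.g. `SolovevFluxSurfaceGGJInputs.lean`). HONEST FRAMING: definitions and
exact identities about MODEL objects (ideal MHD, axisymmetric equilibria); nothing here is a stability claim.
Typer/prover: gridfusion-model-5 (g3), 2026-08-27.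
-/

noncomputable section

namespace Literature.MathematicalPhysics.MHD.GradShafranov

open _root_.Real _root_.MeasureTheory _root_.intervalIntegral FluxGeometry _root_.Set

/-! ## The surface average (5.30) -/

/-- Jardin's SURFACE AVERAGE AS PRINTED, eq. (5.30) `⟨a⟩ = (2π/V′)∫₀^{2π} J a dθ`, written with (5.23)
`J dθ = R dℓ/|∇ψ|` in the label `ψ := Ψ` (so `R/|∇Ψ| = 1/B_p`): `⟨a⟩ = 2π ∮ a dℓ/B_p ÷ V′`, Euclidean arc
length over the loop `γ : [0,T] → (R, Z)` tracing the surface, `V′ = volumeDerivE ψ γ T` ((5.29) = Freidberg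
(6.22)). Junk value `0` when `V′ = 0`. [cite: Jardin2010, §5.3 eq. (5.30)] -/
def surfaceAverageE (ψ : ℝ → ℝ → ℝ) (γ : ℝ → ℝ × ℝ) (T : ℝ) (a : ℝ → ℝ → ℝ) : ℝ :=
  2 * π * loopIntegralE γ T (fun R Z => a R Z / fieldBpol ψ R Z) / volumeDerivE ψ γ T

/-- Pointwise: `1/B_p = R/|∇ψ|` for `R ≥ 0` (`B_p = |∇ψ|/R`, Freidberg (6.3); both sides are `0` in the
degenerate cases `R = 0` or `∇ψ = 0`). [cite: Jardin2010, §5.2 eq. (5.23)] -/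
theorem one_div_fieldBpol_eq {ψ : ℝ → ℝ → ℝ} {R : ℝ} (Z : ℝ) (hR : 0 ≤ R) :
    1 / fieldBpol ψ R Z = R / Real.sqrt (gradSq ψ R Z) := by
  have hsq : fieldBpol ψ R Z = Real.sqrt (gradSq ψ R Z) / R := by
    have h1 : fieldBpol ψ R Z = Real.sqrt (fieldBpol ψ R Z ^ 2) := by
      rw [Real.sqrt_sq]
      unfold fieldBpol
      exact Real.sqrt_nonneg _
    rw [h1, fieldBpol_sq, Real.sqrt_div' _ (sq_nonneg R), Real.sqrt_sq hR]
  rw [hsq, one_div, inv_div]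

/-- **Jardin's `V′` (5.29) is Freidberg's `dV/dψ` (6.22):** for a loop in the closed right half plane,
`volumeDerivE ψ γ T = 2π ∮ R dℓ/|∇ψ|`. [cite: Jardin2010, §5.3 eq. (5.29)] -/
theorem volumeDerivE_eq_jardin {ψ : ℝ → ℝ → ℝ} {γ : ℝ → ℝ × ℝ} {T : ℝ}
    (hR : ∀ t ∈ uIcc 0 T, 0 ≤ (γ t).1) :
    volumeDerivE ψ γ T
      = 2 * π * loopIntegralE γ T (fun R Z => R / Real.sqrt (gradSq ψ R Z)) := by
  unfold volumeDerivE loopIntegralE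
  congr 1
  exact intervalIntegral.integral_congr fun t ht => by
    beta_reduce; rw [one_div_fieldBpol_eq _ (hR t ht)]

/-- Likewise the numerator of `⟨a⟩`: `2π∮ a dℓ/B_p = 2π∮ a R dℓ/|∇ψ|` (= `2π∫ J a dθ` by (5.23)) for a loop in
the closed right half plane. [cite: Jardin2010, §5.3 eq. (5.30)] -/
theorem surfaceAverageE_eq_jardin {ψ : ℝ → ℝ → ℝ} {γ : ℝ → ℝ × ℝ} {T : ℝ} (a : ℝ → ℝ → ℝ)
    (hR : ∀ t ∈ uIcc 0 T, 0 ≤ (γ t).1) :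
    surfaceAverageE ψ γ T a
      = 2 * π * loopIntegralE γ T (fun R Z => a R Z * R / Real.sqrt (gradSq ψ R Z))
          / (2 * π * loopIntegralE γ T (fun R Z => R / Real.sqrt (gradSq ψ R Z))) := by
  unfold surfaceAverageE
  rw [volumeDerivE_eq_jardin hR]
  unfold loopIntegralE
  have e : ∫ t in (0 : ℝ)..T, a (γ t).1 (γ t).2 / fieldBpol ψ (γ t).1 (γ t).2 * speed γ t
      = ∫ t in (0 : ℝ)..T, a (γ t).1 (γ t).2 * (γ t).1 / Real.sqrt (gradSq ψ (γ t).1 (γ t).2)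
          * speed γ t :=
    intervalIntegral.integral_congr fun t ht => by
      rw [div_eq_mul_one_div (a _ _), one_div_fieldBpol_eq _ (hR t ht), mul_div_assoc]
  rw [e]

/-! ## Algebra of the surface average -/

/-- `⟨1⟩ = 1` on a regular surface (`V′ ≠ 0`). [cite: Jardin2010, §5.3 eq. (5.30)] -/
theorem surfaceAverageE_one {ψ : ℝ → ℝ → ℝ} {γ : ℝ → ℝ × ℝ} {T : ℝ} (hV : volumeDerivE ψ γ T ≠ 0) :
    surfaceAverageE ψ γ T (fun _ _ => 1) = 1 := by
  unfold surfaceAverageE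
  exact div_self hV

/-- `⟨a⟩` depends only on the values of `a` along the loop: if `a = b` on `γ([0,T])` then `⟨a⟩ = ⟨b⟩`.
[cite: Jardin2010, §5.3 eq. (5.30)] -/
theorem surfaceAverageE_congr {ψ : ℝ → ℝ → ℝ} {γ : ℝ → ℝ × ℝ} {T : ℝ} {a b : ℝ → ℝ → ℝ}
    (h : ∀ t ∈ uIcc 0 T, a (γ t).1 (γ t).2 = b (γ t).1 (γ t).2) :
    surfaceAverageE ψ γ T a = surfaceAverageE ψ γ T b := by
  unfold surfaceAverageE loopIntegralE
  have e : ∫ t in (0 : ℝ)..T, a (γ t).1 (γ t).2 / fieldBpol ψ (γ t).1 (γ t).2 * speed γ t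
      = ∫ t in (0 : ℝ)..T, b (γ t).1 (γ t).2 / fieldBpol ψ (γ t).1 (γ t).2 * speed γ t :=
    intervalIntegral.integral_congr fun t ht => by rw [h t ht]
  rw [e]

/-- Homogeneity: `⟨c·a⟩ = c⟨a⟩`. [cite: Jardin2010, §5.3 eq. (5.30)] -/
theorem surfaceAverageE_const_mul {ψ : ℝ → ℝ → ℝ} {γ : ℝ → ℝ × ℝ} {T : ℝ} (c : ℝ) (a : ℝ → ℝ → ℝ) :
    surfaceAverageE ψ γ T (fun R Z => c * a R Z) = c * surfaceAverageE ψ γ T a := by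
  unfold surfaceAverageE loopIntegralE
  have e : ∀ t, c * a (γ t).1 (γ t).2 / fieldBpol ψ (γ t).1 (γ t).2 * speed γ t
      = c * (a (γ t).1 (γ t).2 / fieldBpol ψ (γ t).1 (γ t).2 * speed γ t) := fun t => by ring
  simp_rw [e, intervalIntegral.integral_const_mul]
  ring

/-- A surface constant averages to itself: if `a ≡ k` along the loop and `V′ ≠ 0` then `⟨a⟩ = k`.
[cite: Jardin2010, §5.3 eq. (5.30)] -/
theorem surfaceAverageE_of_const {ψ : ℝ → ℝ → ℝ} {γ : ℝ → ℝ × ℝ} {T : ℝ} {a : ℝ → ℝ → ℝ} {k : ℝ}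
    (hV : volumeDerivE ψ γ T ≠ 0) (h : ∀ t ∈ uIcc 0 T, a (γ t).1 (γ t).2 = k) :
    surfaceAverageE ψ γ T a = k := by
  rw [surfaceAverageE_congr (b := fun R Z => k * 1) (fun t ht => by rw [h t ht, mul_one]),
    surfaceAverageE_const_mul, surfaceAverageE_one hV, mul_one]

/-- A surface constant factors out: if `a = k·b` along the loop then `⟨a⟩ = k⟨b⟩` (e.g. `σB² = J·B` is a
surface constant for Solov'ev profiles, so `⟨σB²/|∇ψ|²⟩ = (σB²)·⟨1/|∇ψ|²⟩`). [cite: Jardin2010, §5.3 eq. (5.30)] -/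
theorem surfaceAverageE_of_const_mul {ψ : ℝ → ℝ → ℝ} {γ : ℝ → ℝ × ℝ} {T : ℝ} {a b : ℝ → ℝ → ℝ} {k : ℝ}
    (h : ∀ t ∈ uIcc 0 T, a (γ t).1 (γ t).2 = k * b (γ t).1 (γ t).2) :
    surfaceAverageE ψ γ T a = k * surfaceAverageE ψ γ T b := by
  rw [surfaceAverageE_congr (b := fun R Z => k * b R Z) h, surfaceAverageE_const_mul]

/-- Additivity: `⟨a + b⟩ = ⟨a⟩ + ⟨b⟩` (both loop integrands integrable on `[0, T]`).
[cite: Jardin2010, §5.3 eq. (5.30)] -/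
theorem surfaceAverageE_add {ψ : ℝ → ℝ → ℝ} {γ : ℝ → ℝ × ℝ} {T : ℝ} {a b : ℝ → ℝ → ℝ}
    (ha : IntervalIntegrable (fun t => a (γ t).1 (γ t).2 / fieldBpol ψ (γ t).1 (γ t).2 * speed γ t)
      volume 0 T)
    (hb : IntervalIntegrable (fun t => b (γ t).1 (γ t).2 / fieldBpol ψ (γ t).1 (γ t).2 * speed γ t)
      volume 0 T) :
    surfaceAverageE ψ γ T (fun R Z => a R Z + b R Z)
      = surfaceAverageE ψ γ T a + surfaceAverageE ψ γ T b := by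
  unfold surfaceAverageE loopIntegralE
  have e : ∀ t, (a (γ t).1 (γ t).2 + b (γ t).1 (γ t).2) / fieldBpol ψ (γ t).1 (γ t).2 * speed γ t
      = a (γ t).1 (γ t).2 / fieldBpol ψ (γ t).1 (γ t).2 * speed γ t
        + b (γ t).1 (γ t).2 / fieldBpol ψ (γ t).1 (γ t).2 * speed γ t := fun t => by ring
  simp_rw [e, intervalIntegral.integral_add ha hb]
  ring

/-! ## Jardin's `Φ′` (5.31), `q` (5.35), `I` (5.34) in the label `Ψ`, and consistency with Freidberg -/

/-- The `ψ`-derivative of Jardin's toroidal flux (5.31), `Φ(ψ) = (1/2π)∫_{ψ₀}^{ψ} dψ g V′⟨R⁻²⟩`, i.e. its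
printed integrand `Φ′ = (1/2π) g V′ ⟨R⁻²⟩`, in the label `ψ := Ψ` (`g = F(Ψ)` the value of the free function
on the surface). [cite: Jardin2010, §5.3 eq. (5.31)] -/
def toroidalFluxDerivJ (g : ℝ) (ψ : ℝ → ℝ → ℝ) (γ : ℝ → ℝ × ℝ) (T : ℝ) : ℝ :=
  1 / (2 * π) * g * volumeDerivE ψ γ T * surfaceAverageE ψ γ T (fun R _ => (R ^ 2)⁻¹)

/-- Jardin's safety factor AS PRINTED, (5.35) `q = Φ′/Ψ_p′ = gV′⟨R⁻²⟩/((2π)²Ψ′)`, in the label `ψ := Ψ`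
(`Ψ′ = 1`). [cite: Jardin2010, §5.3 eq. (5.35)] -/
def safetyFactorJ (g : ℝ) (ψ : ℝ → ℝ → ℝ) (γ : ℝ → ℝ × ℝ) (T : ℝ) : ℝ :=
  g * volumeDerivE ψ γ T * surfaceAverageE ψ γ T (fun R _ => (R ^ 2)⁻¹) / (2 * π) ^ 2

/-- Jardin's toroidal current AS PRINTED, (5.34) `I = (Ψ′/2πμ₀) V′⟨|∇ψ|²/R²⟩`, in the label `ψ := Ψ`
(`Ψ′ = 1`, `|∇ψ|² = gradSq ψ`). [cite: Jardin2010, §5.3 eq. (5.34)] -/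
def toroidalCurrentJ (μ0 : ℝ) (ψ : ℝ → ℝ → ℝ) (γ : ℝ → ℝ × ℝ) (T : ℝ) : ℝ :=
  1 / (2 * π * μ0) * volumeDerivE ψ γ T * surfaceAverageE ψ γ T (fun R Z => gradSq ψ R Z / R ^ 2)

/-- `V′·⟨a⟩ = 2π∮ a dℓ/B_p` on a regular surface (`V′ ≠ 0`). [cite: Jardin2010, §5.3 eq. (5.30)] -/
theorem volumeDerivE_mul_surfaceAverageE {ψ : ℝ → ℝ → ℝ} {γ : ℝ → ℝ × ℝ} {T : ℝ}
    (hV : volumeDerivE ψ γ T ≠ 0) (a : ℝ → ℝ → ℝ) :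
    volumeDerivE ψ γ T * surfaceAverageE ψ γ T a
      = 2 * π * loopIntegralE γ T (fun R Z => a R Z / fieldBpol ψ R Z) := by
  unfold surfaceAverageE
  rw [mul_div_cancel₀ _ hV]

/-- **Jardin's `q` (5.35) = Freidberg's `q` (6.35)** (`safetyFactorE`, `(g/2π)∮dℓ/(R²B_p)`) on every regular
surface: the two printed definitions of the safety factor agree. [cite: Jardin2010, §5.3 eq. (5.35)] -/
theorem safetyFactorJ_eq_safetyFactorE {ψ : ℝ → ℝ → ℝ} {γ : ℝ → ℝ × ℝ} {T : ℝ}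
    (hV : volumeDerivE ψ γ T ≠ 0) (g : ℝ) :
    safetyFactorJ g ψ γ T = safetyFactorE g ψ γ T := by
  unfold safetyFactorJ safetyFactorE
  rw [mul_assoc, volumeDerivE_mul_surfaceAverageE hV]
  have e : loopIntegralE γ T (fun R Z => (R ^ 2)⁻¹ / fieldBpol ψ R Z)
      = loopIntegralE γ T (fun R Z => 1 / (R ^ 2 * fieldBpol ψ R Z)) := by
    unfold loopIntegralE
    congr 1; funext t
    beta_reduce
    rw [div_eq_mul_inv, ← mul_inv, one_div]
  rw [e]
  have hπ : (π : ℝ) ≠ 0 := Real.pi_ne_zero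
  field_simp

/-- **`Φ′ = 2πq` in the label `Ψ`:** Jardin's (5.31) integrand equals `2π·safetyFactorE` (so the GGJ input
`Φ″` is `2π dq/dΨ`). [cite: Jardin2010, §5.3 eq. (5.31)] -/
theorem toroidalFluxDerivJ_eq {ψ : ℝ → ℝ → ℝ} {γ : ℝ → ℝ × ℝ} {T : ℝ}
    (hV : volumeDerivE ψ γ T ≠ 0) (g : ℝ) :
    toroidalFluxDerivJ g ψ γ T = 2 * π * safetyFactorE g ψ γ T := by
  rw [← safetyFactorJ_eq_safetyFactorE hV]
  unfold toroidalFluxDerivJ safetyFactorJ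
  have hπ : (π : ℝ) ≠ 0 := Real.pi_ne_zero
  field_simp

/-- Pointwise: `(|∇ψ|²/R²)/B_p = B_p` (`B_p² = |∇ψ|²/R²`, Freidberg (12.32); unconditional, `0/0 = 0`).
[cite: Jardin2010, §5.3 eq. (5.34)] -/
theorem gradSq_div_sq_div_fieldBpol (ψ : ℝ → ℝ → ℝ) (R Z : ℝ) :
    gradSq ψ R Z / R ^ 2 / fieldBpol ψ R Z = fieldBpol ψ R Z := by
  rw [← fieldBpol_sq, sq, mul_self_div_self]

/-- **Jardin's `I` (5.34) = Freidberg's `(1/μ₀)∮B_p dℓ` (6.27)** (`toroidalCurrentE`) on every regular surface.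
[cite: Jardin2010, §5.3 eq. (5.34)] -/
theorem toroidalCurrentJ_eq_toroidalCurrentE {ψ : ℝ → ℝ → ℝ} {γ : ℝ → ℝ × ℝ} {T : ℝ}
    (hV : volumeDerivE ψ γ T ≠ 0) (μ0 : ℝ) :
    toroidalCurrentJ μ0 ψ γ T = toroidalCurrentE μ0 ψ γ T := by
  unfold toroidalCurrentJ toroidalCurrentE
  rw [mul_assoc, volumeDerivE_mul_surfaceAverageE hV]
  have e : loopIntegralE γ T (fun R Z => gradSq ψ R Z / R ^ 2 / fieldBpol ψ R Z)
      = loopIntegralE γ T (fieldBpol ψ) := by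
    unfold loopIntegralE
    congr 1; funext t
    beta_reduce
    rw [gradSq_div_sq_div_fieldBpol]
  rw [e]
  have hπ : (π : ℝ) ≠ 0 := Real.pi_ne_zero
  by_cases hμ : μ0 = 0
  · simp [hμ]
  · field_simp

end Literature.MathematicalPhysics.MHD.GradShafranov
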